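import Mathlib
import Summits.ResolutionOfSingularities.ResolutionOfSingularities.Theorems.HomologicalConductorPersistenceConductorFloor
import Literature.RingTheory.CohomologyAnnihilator.RegularRing
import HarnessLib

/-!
# Rung S-2 `PersistenceSurface` (stmt-ResolutionOfSingularities-19970) — the conductor floor in the ROUTE'S VOCABULARY
# (subalgebras `B ≤ C` of a field `K` with `Frac B = K`)

Route `ResolutionOfSingularities/HomologicalConductor`, chain W4.4b (cell `res-hironaka`), rung S-2 `PersistenceSurface`
(stmt-ResolutionOfSingularities-19970), registered stub `stub_levelFourPersistenceNonnormalOrNonrational'` (L-other′; Σ8 =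
non-normal stage `0`), cell R5 / S-c.  Seat res-L1-w44b-lead-1 (gen 3).  `[OURS · L1 w44b]`; folklore; NOT a statement of
the manuscript under review (Hironaka 2017); AI-written, weaker than expert review.

The principal-conductor floor of `…PersistenceConductorFloor` (p552596: `a·(a·y) ∈ ca³(B)` for `y ∈ ca³(C)`, for an
injective birational `B → C` with conductor `a·C`) is stated there for an abstract algebra `B → C`.  The canonical tower
of the route lives inside ONE field `K`: its stages are `Subalgebra k K`'s with `Frac = K`, and the non-normal stage `0`
sits inside its normalisation `T₀ ≤ T̄₀ ≤ K`.  This file is the ADAPTER: for subalgebras `B ≤ C` of `K` with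
`IsFractionRing ↥B K` (so `C ⊆ Frac B` automatically) and a principal conductor `(B : C) = a·C`,

* `Subalgebra.coe_mul_mul_mem_cohomologyAnnihilatorOfDegree_three` — for every `y ∈ ca³(↥C)`, the element `a·(a·y)` of `B`
  lies in `ca³(↥B)`;

the companion ceiling in the same vocabulary is `PersistenceConductorCeiling.Subalgebra.coe_mul_mem_of_mem_cohomologyAnnihilatorOfDegree_three`
(p550697): `x ∈ ca³(↥B) ⇒ x·C ⊆ B`.  Together: `a²·ca³(T̄₀) ⊆ ca³(T₀) ⊆ a·T̄₀` at a non-normal stage with principal conductor.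

References (mechanism only): S. B. Iyengar, R. Takahashi, IMRN 2016, Remark 2.13 [`IyengarTakahashi2014`].
-/

-- single-problem summit: the doubled namespace component `ResolutionOfSingularities` is forced
set_option linter.dupNamespace false

noncomputable section

open Literature.RingTheory.CohomologyAnnihilator
open scoped nonZeroDivisors

namespace Summit.ResolutionOfSingularities.ResolutionOfSingularities.Theorems.HomologicalConductor.PersistenceConductorFloor

variable {k K : Type} [Field k] [Field K] [Algebra k K]

/-- **The principal-conductor floor for subalgebras of a field.**  `B ≤ C` subalgebras of `K` with `Frac B = K`, both
noetherian, `a ∈ B` nonzero with `a·C ⊆ B` and `(B : C) ⊆ a·C`: for every `y ∈ ca³(↥C)` the element `a·(a·y) ∈ B`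
lies in `ca³(↥B)` (`mul_mul_mem_cohomologyAnnihilatorOfDegree_three` for the algebra `↥B → ↥C` given by the
inclusion). [cite: IyengarTakahashi2014, Remark 2.13] -/
theorem Subalgebra.coe_mul_mul_mem_cohomologyAnnihilatorOfDegree_three (B C : Subalgebra k K) (hBC : B ≤ C)
    [IsFractionRing ↥B K] [IsNoetherianRing ↥B] [IsNoetherianRing ↥C] {a : ↥B} (ha0 : (a : K) ≠ 0)
    (haC : ∀ γ ∈ C, (a : K) * γ ∈ B)
    (h𝔠 : ∀ b ∈ B, (∀ γ ∈ C, b * γ ∈ B) → ∃ w ∈ C, b = (a : K) * w)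
    {y : ↥C} (hy : y ∈ cohomologyAnnihilatorOfDegree ↥C 3) :
    ∃ h : (a : K) * ((a : K) * (y : K)) ∈ B, (⟨_, h⟩ : ↥B) ∈ cohomologyAnnihilatorOfDegree ↥B 3 := by
  classical
  letI : Algebra ↥B ↥C := (Subalgebra.inclusion hBC).toRingHom.toAlgebra
  have halg : ∀ b : ↥B, ((algebraMap ↥B ↥C b : ↥C) : K) = (b : K) := fun _ => rfl
  have hinj : Function.Injective (algebraMap ↥B ↥C) := Subalgebra.inclusion_injective hBC
  -- birationality: every element of `C ⊆ K = Frac B` has a denominator in `B`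
  have hbir : ∀ γ : ↥C, ∃ b : ↥B, b ≠ 0 ∧ ∃ b' : ↥B, algebraMap ↥B ↥C b' = algebraMap ↥B ↥C b * γ := by
    intro γ
    obtain ⟨⟨r, d⟩, hrd⟩ := IsLocalization.surj (↥B)⁰ (γ : K)
    -- `hrd : ↑γ * algebraMap ↥B K ↑d = algebraMap ↥B K r`
    refine ⟨d, nonZeroDivisors.coe_ne_zero d, r, Subtype.ext ?_⟩
    rw [halg, Subalgebra.coe_mul, halg, mul_comm]
    exact hrd.symm
  have ha : ∀ γ : ↥C, ∃ b : ↥B, algebraMap ↥B ↥C b = algebraMap ↥B ↥C a * γ := fun γ =>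
    ⟨⟨(a : K) * γ, haC γ γ.2⟩, Subtype.ext (by rw [halg, Subalgebra.coe_mul, halg])⟩
  have ha0' : algebraMap ↥B ↥C a ≠ 0 := fun h => ha0 (by
    have := congrArg (fun z : ↥C => (z : K)) h
    simpa [halg] using this)
  have h𝔠' : ∀ b : ↥B, (∀ γ : ↥C, ∃ b' : ↥B, algebraMap ↥B ↥C b' = algebraMap ↥B ↥C b * γ) →
      ∃ w : ↥C, algebraMap ↥B ↥C b = algebraMap ↥B ↥C a * w := by
    intro b hb
    have hb' : ∀ γ ∈ C, (b : K) * γ ∈ B := by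
      intro γ hγ
      obtain ⟨b', hb'⟩ := hb ⟨γ, hγ⟩
      have := congrArg (fun z : ↥C => (z : K)) hb'
      simp only [halg, Subalgebra.coe_mul] at this
      rw [← this]
      exact b'.2
    obtain ⟨w, hwC, hw⟩ := h𝔠 b b.2 hb'
    exact ⟨⟨w, hwC⟩, Subtype.ext (by rw [halg, Subalgebra.coe_mul, halg]; exact hw)⟩
  have hmem : (a : K) * (y : K) ∈ B := haC y y.2
  have hb : algebraMap ↥B ↥C ⟨(a : K) * (y : K), hmem⟩ = algebraMap ↥B ↥C a * y :=
    Subtype.ext (by rw [halg, Subalgebra.coe_mul, halg])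
  have key := mul_mul_mem_cohomologyAnnihilatorOfDegree_three hinj hbir ha ha0' h𝔠' hy hb
  refine ⟨B.mul_mem a.2 hmem, ?_⟩
  have heq : (⟨(a : K) * ((a : K) * (y : K)), B.mul_mem a.2 hmem⟩ : ↥B) = a * ⟨(a : K) * (y : K), hmem⟩ :=
    Subtype.ext rfl
  rw [heq]
  exact key


/-! ## Appendix: REGULAR normalisation — `𝔠² ⊆ ca³(B)` (the surface analogue of the curve floor `𝔠 ⊆ ca²`) -/

universe u in
/-- **`𝔠² ⊆ ca³(B)` when the overring is REGULAR of dimension `≤ 2` and the conductor is principal.**  For an injective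
birational `B → C` of noetherian rings with `C` a regular domain of Krull dimension `≤ 2` and principal conductor
`𝔠 = a·C`: the product of any two conductor elements lies in `ca³(B)` (the floor with `y = 1 ∈ ca³(C) = C`,
`cohomologyAnnihilatorOfDegree_eq_top_of_isRegularRing`).  With the ceiling: `𝔠² ⊆ ca³(B) ⊆ 𝔠` for every non-normal
surface germ with regular normalisation and principal conductor — the two-dimensional analogue of the fact-free curve
floor `𝔠 ⊆ ca²` (`…PersistenceConductorStablyAnnihilates`). [cite: IyengarTakahashi2014, Remark 2.13] -/
theorem mul_mem_cohomologyAnnihilatorOfDegree_three_of_isRegularRing {B C : Type u} [CommRing B] [CommRing C]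
    [Algebra B C] [IsNoetherianRing B] [IsDomain C] [IsRegularRing C]
    (hdim : ringKrullDim C ≤ (2 : ℕ)) (hinj : Function.Injective (algebraMap B C))
    (hbir : ∀ γ : C, ∃ b : B, b ≠ 0 ∧ ∃ b' : B, algebraMap B C b' = algebraMap B C b * γ)
    {a : B} (ha : ∀ γ : C, ∃ b : B, algebraMap B C b = algebraMap B C a * γ) (ha0 : algebraMap B C a ≠ 0)
    (h𝔠 : ∀ b : B, (∀ γ : C, ∃ b' : B, algebraMap B C b' = algebraMap B C b * γ) →
      ∃ w : C, algebraMap B C b = algebraMap B C a * w)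
    {c c' : B} (hc : ∀ γ : C, ∃ b : B, algebraMap B C b = algebraMap B C c * γ)
    (hc' : ∀ γ : C, ∃ b : B, algebraMap B C b = algebraMap B C c' * γ) :
    c * c' ∈ cohomologyAnnihilatorOfDegree B 3 := by
  have h1 : (1 : C) ∈ cohomologyAnnihilatorOfDegree C 3 := by
    rw [cohomologyAnnihilatorOfDegree_eq_top_of_isRegularRing (A := C) (n := 2) hdim]
    exact Submodule.mem_top
  exact mul_mem_cohomologyAnnihilatorOfDegree_three_of_conductor hinj hbir ha ha0 h𝔠 hc hc' h1 (b := c')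
    (by rw [mul_one])

end Summit.ResolutionOfSingularities.ResolutionOfSingularities.Theorems.HomologicalConductor.PersistenceConductorFloor

end
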